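import Summits.BirchSwinnertonDyer.Rank1Residual.Additive.X4RankZeroVisibleRefinedCertificateSockets
import Summits.BirchSwinnertonDyer.Rank1Residual.GaloisImage.VisThreeESideInstancesP1
import Summits.BirchSwinnertonDyer.Rank1Residual.GaloisImage.LocalThreeTorsionAdicCompletion
import Summits.BirchSwinnertonDyer.Rank1Residual.GaloisImage.LocalTorsionAwayFromPAdicCompletion
import Summits.BirchSwinnertonDyer.Rank1Residual.GaloisImage.PadicTwistClassDecider
import Summits.BirchSwinnertonDyer.Rank1Residual.Additive.IntModelTamagawaCertificateLocal
import Summits.BirchSwinnertonDyer.Rank1Residual.Additive.JValuationOfIntModel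
import Summits.BirchSwinnertonDyer.Rank1Residual.X11b.VisibilityPrimeList
import Literature.NumberTheory.EllipticCurves.HondaStrongIsomorphismMultiplicativeProofs
import HarnessLib

/-!
# T-NSK-REC ROW SHAPES: `BSD(E,3)` for `52695f1` (partner `10539c1`), `57195f1` (partner `11439d1`)
# over the REFINED seven-kind certificate — the place `3` PAID (`t₃ = 1`),
# one place FREE of kind (iv′), the partner's other bad places of kind (i) (n1011-p18's tame recipe) or
# (iii); every local binder IN THE KERNEL (cell `b2b-bsdres`, team n1011, ROW T-2LL FILE 9; lead
# R5-86 (r); seat p04 GEN 11; token-for-token the pilot `X4ThreeVisibleNskRowShape62514b1.lean` over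
# FILE 6's socket `X4RankZero.bsdp_three_potMult_of_congr_of_places₇_of_primeList_paidThree`)

HONEST FRAMING (cell `b2b-bsdres`, run/shared/lean/b2b/bsd-rank1-residual/, verbatim in every
file): the goal of the cell is to DELETE the COMBINATION-SHAPED residual classes of the
Birch–Swinnerton-Dyer formula for ALL analytic-rank `≤ 1` elliptic curves over `ℚ` — "full BSD
formula for every rank `≤ 1` curve in class `C`" assembled STRICTLY from published theorems — so
that the rank-`≤ 1` remainder becomes exactly the CONSTRUCTION-SHAPED classes, which are TYPED
(missing-input `Prop`s), NOT attempted. This is not "finishing BSD". Team n1011 (N11 = X4 ∧ `p = 3`),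
research route; a ROW SHAPE closes NO class and moves no mark / label / count; nothing booked;
theorems only (no definition, no named fact, no `sorry`).

RULING OF RECORD for row shapes (n1011 lead GEN 8, R5-82 (d), verbatim): "T-VIS3 (iv) ROW SHAPE —
evidence columns displayed as binders, provenance: θ = r1 g29 tables (+ KO/Fisher certificate when
landed), rank E′ = Cremona/bsdr2, r_an/#Ш_an = Cremona allbsd + engine P; nothing booked; closes
nothing beyond its displayed binders; census count unchanged".

## What (route planner 1 `g29_cvis_pairs.tsv`, road PASS⁺ of ROUTE-1 §41.9; every `E` below is X4 at `3`,
## (M), `r_an = 0`, `ord₃ #Ш_an = 2`; every partner has rank `2`; recipe rows not in this file are in its sibling)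

* **`bsdp3_visN_v52695f1`** — `52695f1 = [1, -1, 1, 7762, -3252108]` (`I₁₆*`, `ord₃ j = -16`), partner
  `10539c1 = [1, -1, 1, -5, 78]`; places `3 → PAID (t₃ = 1; cert k = 2, ball (4,1,3,0));
  5:nonsplit/good → (iv′); 1171:nonsplit/nonsplit, t = 1 → (i)`; `|Δ| = 3²²·5³·1171 / 3⁷·1171`.
* **`bsdp3_visN_v57195f1`** — `57195f1 = [1, -1, 0, 126855, -8937104]` (`I₆*`, `ord₃ j = -6`), partner
  `11439d1 = [0, 0, 1, -75, -68]`; places `3 → PAID (cert k = 3, ball (15,1,3,0)); 5 → (iv′); 31 → (i);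
  41 → (iii)`; `|Δ| = 3¹²·5¹²·31·41 / 3⁹·31·41`.
* **`bsdp3_visN_v29358a1`** — `29358a1 = [1, -1, 0, 1220004, 985551952]` (`I₈*`, `ord₃ j = -8`), partner
  `14679c1 = [0, 0, 1, -192, 616]`; places `2 → (iv′); 3 → PAID (cert k = 3, ball (24,1,3,0)); 7 → (i);
  233 → (iii)`; `|Δ| = 2³⁶·3¹⁴·7·233 / 3¹¹·7·233`.

KERNEL per row: surj(3) = n1011-p14's `GaloisImage.surj3_frob_v<label>` (E-INST-P1, BY NAME); X4 and
`ord₃ j < 0` from the integer model; partner globally minimal (bounded Kraus); the place `3` by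
n1011-p17's decider (certificates found by n1011-p17's `census/loc3t_cert2.py` UNCHANGED through
n1011-p18's `tools/vis3_certs.py`); kind (i) by n1011-p18's tame recipe
`LocalTorsionAway.natCard_ker_nsmul_adicCompletion_eq_one_of_intModel_of_nodal_euler` (non-split `I₁`,
Euler witness, `TamLocal` certificate, `3 ∤ c·(ℓ+1)`) — the Lean line EMITTED by `vis3_certs.py`
UNCHANGED; kind (iv′) / (iii) numerals by the seat's `pilot/numerals.py`, flags `decide +kernel`.
DISPLAYED = EVIDENCE: `θ`/`hθ`, `hrank`, `hr`, `hq`/`hv`.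

References: [CremonaMazur2000] §3 and Table 1; [AgasheStein2002] Thm. 3.1; [Delbourgo1998] Prop. 4;
[MilneADT2006] I.3.8; [SilvermanAEC2009] VII.2.1, VII.5.1, X.4.2, X.4.14; [SilvermanATAEC1994] IV.9.4,
V.5.2–5.4; [Serre1973] II.3.3; [Cremona2006] (labels above).
-/

set_option autoImplicit false

noncomputable section

open scoped Classical NumberField
open IsDedekindDomain NumberField WeierstrassCurve Rat.HeightOneSpectrum
  Literature.NumberTheory.EllipticCurves Literature.NumberTheory.EllipticCurves.ModularForms
  Literature.NumberTheory.EllipticCurves.Rank1Residual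
  Literature.NumberTheory.EllipticCurves.Rank1Residual.Typed
  Literature.NumberTheory.GaloisRepresentations
  Summit.BirchSwinnertonDyer.BirchSwinnertonDyer.Rank1Residual.IntModel
  Summit.BirchSwinnertonDyer.BirchSwinnertonDyer.Rank1Residual.X11RankOne
  Summit.BirchSwinnertonDyer.BirchSwinnertonDyer.Rank2Observatory
  Summit.BirchSwinnertonDyer.BirchSwinnertonDyer.Rank2Observatory.Tam
  Summit.BirchSwinnertonDyer.Rank1Residual.GaloisImage

namespace Summit.BirchSwinnertonDyer.Rank1Residual.Additive

/-! ### `52695f1` ~ `10539c1` -/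

/-- **NON-SPLIT NUMERAL for `52695f1` at the place of `5`, decided** (kind (iv′)'s `¬ IsSquare (ι γ(E))`):
`γ(E) = −c₄/c₆ = 41399/312016047`, `5 ∤ N·D`, `sqFlagAt 5 (N·D) 0 = false`.
[cite: SilvermanATAEC1994, Ch. V Thm. 5.3 (b)] [cite: Serre1973, Ch. II §3.3] -/
theorem nonsplit_numeral_52695f1_at5 (W : WeierstrassCurve ℚ) (hW : W = ⟨1, -1, 1, 7762, -3252108⟩)
    {v : HeightOneSpectrum (𝓞 ℚ)} (hv : (primesEquiv v : ℕ) = 5) :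
    ¬ IsSquare (algebraMap ℚ (v.adicCompletion ℚ) (-(W.c₄ / W.c₆))) := by
  haveI : Fact (Nat.Prime 5) := ⟨by norm_num⟩
  subst hW
  exact LocalTorsion3At.not_isSquare_algebraMap_adicCompletion_of_sqFlagAt v hv (N := 41399)
    (D := 312016047) (by norm_num)
    (by norm_num [WeierstrassCurve.c₄, WeierstrassCurve.c₆, WeierstrassCurve.b₂, WeierstrassCurve.b₄,
      WeierstrassCurve.b₆]) (w := 0) (by norm_num) (by norm_num) (by decide +kernel)

/-- The kind-3 (non-split by Euler) local Tamagawa certificate of the partner `10539c1` at `1171`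
(`TamLocal` = `⟨1171, 34, 3, 0, 0, 0, 0, 1, 0, 0, 1⟩`, `c = 1`) passes the kernel check (n1011-p18's `tools/vis3_certs.py`).
[cite: SilvermanATAEC1994, IV.9.4] -/
theorem tamLocal_check_10539c1_1171 :
    TamLocal.check ⟨1171, 34, 3, 0, 0, 0, 0, 1, 0, 0, 1⟩ ⟨1, -1, 1, -5, 78⟩ = true := by
  decide +kernel

/-- The Euler witness of NON-split reduction of `10539c1` at `1171`: `d^((1171-1)/2) = -1` in `ℤ/1171` for the
discriminant `d` of the node-tangent quadratic. [cite: SilvermanAEC2009, VII.5 Prop. 5.1(b)] -/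
theorem nodal_euler_10539c1_1171 :
    ((RootNumber.nodalDisc ⟨1, -1, 1, -5, 78⟩ : ℤ) : ZMod 1171) ^ (1171 / 2) = -1 := by
  decide +kernel

/-- **T-NSK-REC ROW SHAPE (CLOSES NOTHING, moves no mark): `BSD(E,3)` for `52695f1` from its `3`-congruent
rank-2 partner `10539c1` over the refined seven-kind certificate — the place `3` PAID (`#E′(ℚ₃)[3] = 1`, budget `3 < 3²`), the place `5` of kind (iv′), the place `1171` of kind (i); every local binder in the
kernel.** [cite: CremonaMazur2000, §3 and Table 1] [cite: AgasheStein2002, Thm. 3.1]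
[cite: MilneADT2006, Ch. I Prop. 3.8] [cite: SilvermanATAEC1994, IV.9.4, Ch. V Lemma 5.2 (c), Thm. 5.3, Cor. 5.4]
[cite: SilvermanAEC2009, VII.2.1, VII.5 Prop. 5.1, Thm. X.4.2 (a) and X.4.14]
[cite: Cremona2006, Table 1 (labels 52695f1, 10539c1)] -/
theorem bsdp3_visN_v52695f1
    (hKatoS : Kato2004.rankZero_padicValNat_sha_le_sub_localTamagawa_of_additive_potGood_of_imageContainsSL2)
    (hDel : Delbourgo1998.prop4_rankZero_pow_dvd_constantCoeff)
    (hGZK : rank_eq_analyticRank_of_analyticRank_le_one) (hmod : hasEntireLFunction_rat)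
    (hmodD : nonempty_modularParametrizationData)
    (hKatoχ : Wuthrich2014.kato_halfEigenCharIdeal_dvd_cyclotomicPrime_of_surjective)
    (hCT : exists_casselsTate_pairing (K := ℚ))
    (hU : Silverman1994_thmV53_tateUniformisation.{0})
    (hU2 : Silverman1994_thmV53_corV54_tateUniformisation.{0})
    (W : WeierstrassCurve ℚ) [W.IsElliptic] [W.IsGloballyMinimal]
    (hI : integralModelInt W = ⟨1, -1, 1, 7762, -3252108⟩)
    (hr : W.analyticRank = 0)
    {q : ℚ} (hq : shaAn W = (q : ℂ)) (hv : padicValRat 3 q ≤ 2)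
    (W' : WeierstrassCurve ℚ) (hW' : W' = ⟨1, -1, 1, -5, 78⟩) [W'.IsElliptic]
    (θ : geomTorsion W' ((3 : ℕ) : ℤ) ≃+ geomTorsion W ((3 : ℕ) : ℤ))
    (hθ : ∀ (σ : Field.absoluteGaloisGroup ℚ) (P : geomTorsion W' ((3 : ℕ) : ℤ)),
      θ (σ • P) = σ • θ P)
    (hrank : 2 ≤ W'.mordellWeilRank) :
    haveI : Fact (Nat.Prime 3) := ⟨Nat.prime_three⟩
    BSDp W 3 := by
  haveI : Fact (Nat.Prime 3) := ⟨Nat.prime_three⟩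
  haveI : Fact (Nat.Prime 5) := ⟨by norm_num⟩
  haveI : Fact (Nat.Prime 1171) := ⟨by norm_num⟩
  -- the row `52695f1`
  have hsurj : W.HasSurjectiveModNGaloisRep 3 := GaloisImage.surj3_frob_v52695f1 hI
  have hX : ClassX4 W 3 :=
    ⟨by norm_num, addv_of_intModel hI 3 (by decide) (by decide),
      hasIrreducibleModPGaloisRep_of_hasSurjectiveModNGaloisRep W 3 hsurj⟩
  have hj : padicValRat 3 W.j < 0 :=
    padicValRat_j_neg_of_intModel hI (p := 3) 2 (by decide) (by decide)
  have hE : (⟨1, -1, 1, 7762, -3252108⟩ : WeierstrassCurve ℤ).map (Int.castRingHom ℚ) = W := by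
    rw [IntModelTam.eq_baseChange_of_integralModelInt hI]; rfl
  have hW : W = ⟨1, -1, 1, 7762, -3252108⟩ := by
    rw [← hE]; exact map_mk_int 1 (-1) 1 7762 (-3252108)
  -- the partner `10539c1`: globally minimal, integral model
  haveI hM' : W'.IsGloballyMinimal := by
    rw [hW']
    exact isGloballyMinimal_of_krausCriterion_bounded 1 (-1) 1 (-5) 78
      (by decide +kernel) (by decide +kernel) (by decide +kernel)
  have hI' : integralModelInt W' = ⟨1, -1, 1, -5, 78⟩ := by
    subst hW'; exact integralModelInt_eq_of_map_eq _ (map_mk_int 1 (-1) 1 (-5) 78)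
  have hF : (⟨1, -1, 1, -5, 78⟩ : WeierstrassCurve ℤ).map (Int.castRingHom ℚ) = W' := by
    rw [hW']; exact map_mk_int 1 (-1) 1 (-5) 78
  refine X4RankZero.bsdp_three_potMult_of_congr_of_places₇_of_primeList_paidThree hKatoS hDel hGZK
    hmod hmodD hKatoχ hCT hU hU2 W hr hX hsurj hj hq hv W' θ hθ (t := 1) (k := 2)
    (fun w hw ↦ (LocalTorsion3.natCard_ker_nsmul_three_adicCompletion_eq_one_of_check 1 (-1) 1 (-5) 78
      (by decide +kernel) (k := 2) (cert := [((4 : ℤ), 1, 3, 0)]) (by decide +kernel) W' hW' hw).le)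
    (by norm_num) hrank hE hF [3, 5, 1171] (by decide)
    (X11b.forall_mem_of_natAbs_eq_prod_pow [3, 5, 1171] [22, 3, 1] (by intro q hq; simp only [List.mem_cons, List.mem_nil_iff, or_false] at hq; rcases hq with rfl | rfl | rfl <;> norm_num) (by decide +kernel))
    (X11b.forall_mem_of_natAbs_eq_prod_pow [3, 5, 1171] [7, 0, 1] (by intro q hq; simp only [List.mem_cons, List.mem_nil_iff, or_false] at hq; rcases hq with rfl | rfl | rfl <;> norm_num) (by decide +kernel))
    (fun v hvL hv3 ↦ ?_)
  simp only [List.mem_cons, List.mem_nil_iff, or_false] at hvL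
  rcases hvL with h3 | h5 | h1171
  · -- `v = 3`: the PAID place, excluded here
    exact absurd h3 hv3
  · -- `v = 5`: kind (iv′) — `E` non-split multiplicative, `E′` good, `5 ≠ 3`
    have h5z : ((primesEquiv v : ℕ) : ℤ) = ((5 : ℕ) : ℤ) := by rw [h5]
    refine Or.inr <| Or.inr <| Or.inr <| Or.inl ⟨?_, nonsplit_numeral_52695f1_at5 W hW h5, ?_, ?_⟩
    · exact W.hasMultiplicativeReductionAt_of_dvd_of_not_dvd v
        (by rw [minimalDiscriminantInt, hI, h5z]; decide +kernel) (by rw [hI, h5z]; decide +kernel)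
    · rw [← hF]
      exact hasGoodReductionAt_map_of_not_dvd _ v (by rw [h5z]; decide +kernel)
    · intro hmem
      have h3' := Rat.HeightOneSpectrum.primesEquiv_eq_of_natCast_mem v Nat.prime_three hmem
      omega
  · -- `v = 1171`: kind (i) — the partner is non-split `I₁`, `c = 1`, `3 ∤ 1·(1171+1)` (p18's recipe)
    refine Or.inl ⟨fun hmem ↦ ?_, ?_⟩
    · have h3' := Rat.HeightOneSpectrum.primesEquiv_eq_of_natCast_mem v Nat.prime_three hmem
      omega
    · exact LocalTorsionAway.natCard_ker_nsmul_adicCompletion_eq_one_of_intModel_of_nodal_euler hI' 1171 3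
        (by norm_num) h1171 (by decide) (by decide) (by norm_num) nodal_euler_10539c1_1171
        (E := ⟨1171, 34, 3, 0, 0, 0, 0, 1, 0, 0, 1⟩) rfl tamLocal_check_10539c1_1171 (c := 1) (by decide) (by norm_num)

/-! ### `57195f1` ~ `11439d1` -/

/-- **NON-SPLIT NUMERAL for `57195f1` at the place of `5`, decided** (kind (iv′)'s `¬ IsSquare (ι γ(E))`):
`γ(E) = −c₄/c₆ = 676559/854917467`, `5 ∤ N·D`, `sqFlagAt 5 (N·D) 0 = false`.
[cite: SilvermanATAEC1994, Ch. V Thm. 5.3 (b)] [cite: Serre1973, Ch. II §3.3] -/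
theorem nonsplit_numeral_57195f1_at5 (W : WeierstrassCurve ℚ) (hW : W = ⟨1, -1, 0, 126855, -8937104⟩)
    {v : HeightOneSpectrum (𝓞 ℚ)} (hv : (primesEquiv v : ℕ) = 5) :
    ¬ IsSquare (algebraMap ℚ (v.adicCompletion ℚ) (-(W.c₄ / W.c₆))) := by
  haveI : Fact (Nat.Prime 5) := ⟨by norm_num⟩
  subst hW
  exact LocalTorsion3At.not_isSquare_algebraMap_adicCompletion_of_sqFlagAt v hv (N := 676559)
    (D := 854917467) (by norm_num)
    (by norm_num [WeierstrassCurve.c₄, WeierstrassCurve.c₆, WeierstrassCurve.b₂, WeierstrassCurve.b₄,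
      WeierstrassCurve.b₆]) (w := 0) (by norm_num) (by norm_num) (by decide +kernel)

/-- The kind-3 (non-split by Euler) local Tamagawa certificate of the partner `11439d1` at `31`
(`TamLocal` = `⟨31, 5, 3, 0, 0, 0, 0, 1, 0, 0, 1⟩`, `c = 1`) passes the kernel check (n1011-p18's `tools/vis3_certs.py`).
[cite: SilvermanATAEC1994, IV.9.4] -/
theorem tamLocal_check_11439d1_31 :
    TamLocal.check ⟨31, 5, 3, 0, 0, 0, 0, 1, 0, 0, 1⟩ ⟨0, 0, 1, -75, -68⟩ = true := by
  decide +kernel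

/-- The Euler witness of NON-split reduction of `11439d1` at `31`: `d^((31-1)/2) = -1` in `ℤ/31` for the
discriminant `d` of the node-tangent quadratic. [cite: SilvermanAEC2009, VII.5 Prop. 5.1(b)] -/
theorem nodal_euler_11439d1_31 :
    ((RootNumber.nodalDisc ⟨0, 0, 1, -75, -68⟩ : ℤ) : ZMod 31) ^ (31 / 2) = -1 := by
  decide +kernel

/-- **KIND (iii) NUMERALS for `57195f1 ~ 11439d1` at the place of `41`, decided**: `γ(E)/γ(E′) = N/D` with
`N = -676559`, `D = 52577950`, `41 ∤ N·D`, `sqFlagAt 41 (N·D) 0 = true`; `μ₃(ℚ_41) = 1`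
(`41 ≡ 2 (mod 3)`: `sqFlagAt 41 (−3) 0 = false`). [cite: SilvermanATAEC1994, Ch. V Lemma 5.2 (c), Thm. 5.3]
[cite: Serre1973, Ch. II §3.3] -/
theorem kind_iii_numerals_57195f1_11439d1_at41 (W E' : WeierstrassCurve ℚ)
    (hW : W = ⟨1, -1, 0, 126855, -8937104⟩) (hE' : E' = ⟨0, 0, 1, -75, -68⟩)
    {v : HeightOneSpectrum (𝓞 ℚ)} (hv : (primesEquiv v : ℕ) = 41) :
    (∃ r : v.adicCompletion ℚ, algebraMap ℚ (v.adicCompletion ℚ) (-(W.c₄ / W.c₆)) =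
        r ^ 2 * algebraMap ℚ (v.adicCompletion ℚ) (-(E'.c₄ / E'.c₆))) ∧
      (∀ ζ : v.adicCompletion ℚ, ζ ^ 3 = 1 → ζ = 1) := by
  haveI : Fact (Nat.Prime 41) := ⟨by norm_num⟩
  subst hW; subst hE'
  refine ⟨?_, LocalTorsion3At.forall_pow_three_eq_one_adicCompletion_of_sqFlagAt v hv (w₃ := 0)
    (by norm_num) (by norm_num) (by decide +kernel)⟩
  refine LocalTorsion3At.exists_eq_sq_mul_of_sqFlagAt v hv (N := -676559)
    (D := 52577950) ?_ (by norm_num) ?_ (w := 0) (by norm_num) (by norm_num) (by decide +kernel)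
  · norm_num [WeierstrassCurve.c₄, WeierstrassCurve.c₆, WeierstrassCurve.b₂, WeierstrassCurve.b₄,
      WeierstrassCurve.b₆]
  · norm_num [WeierstrassCurve.c₄, WeierstrassCurve.c₆, WeierstrassCurve.b₂, WeierstrassCurve.b₄,
      WeierstrassCurve.b₆]

/-- **T-NSK-REC ROW SHAPE (CLOSES NOTHING, moves no mark): `BSD(E,3)` for `57195f1` from its `3`-congruent
rank-2 partner `11439d1` over the refined seven-kind certificate — the place `3` PAID (`#E′(ℚ₃)[3] = 1`, budget `3 < 3²`), the place `5` of kind (iv′), the place `31` of kind (i), the place `41` of kind (iii); every local binder in the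
kernel.** [cite: CremonaMazur2000, §3 and Table 1] [cite: AgasheStein2002, Thm. 3.1]
[cite: MilneADT2006, Ch. I Prop. 3.8] [cite: SilvermanATAEC1994, IV.9.4, Ch. V Lemma 5.2 (c), Thm. 5.3, Cor. 5.4]
[cite: SilvermanAEC2009, VII.2.1, VII.5 Prop. 5.1, Thm. X.4.2 (a) and X.4.14]
[cite: Cremona2006, Table 1 (labels 57195f1, 11439d1)] -/
theorem bsdp3_visN_v57195f1
    (hKatoS : Kato2004.rankZero_padicValNat_sha_le_sub_localTamagawa_of_additive_potGood_of_imageContainsSL2)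
    (hDel : Delbourgo1998.prop4_rankZero_pow_dvd_constantCoeff)
    (hGZK : rank_eq_analyticRank_of_analyticRank_le_one) (hmod : hasEntireLFunction_rat)
    (hmodD : nonempty_modularParametrizationData)
    (hKatoχ : Wuthrich2014.kato_halfEigenCharIdeal_dvd_cyclotomicPrime_of_surjective)
    (hCT : exists_casselsTate_pairing (K := ℚ))
    (hU : Silverman1994_thmV53_tateUniformisation.{0})
    (hU2 : Silverman1994_thmV53_corV54_tateUniformisation.{0})
    (W : WeierstrassCurve ℚ) [W.IsElliptic] [W.IsGloballyMinimal]
    (hI : integralModelInt W = ⟨1, -1, 0, 126855, -8937104⟩)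
    (hr : W.analyticRank = 0)
    {q : ℚ} (hq : shaAn W = (q : ℂ)) (hv : padicValRat 3 q ≤ 2)
    (W' : WeierstrassCurve ℚ) (hW' : W' = ⟨0, 0, 1, -75, -68⟩) [W'.IsElliptic]
    (θ : geomTorsion W' ((3 : ℕ) : ℤ) ≃+ geomTorsion W ((3 : ℕ) : ℤ))
    (hθ : ∀ (σ : Field.absoluteGaloisGroup ℚ) (P : geomTorsion W' ((3 : ℕ) : ℤ)),
      θ (σ • P) = σ • θ P)
    (hrank : 2 ≤ W'.mordellWeilRank) :
    haveI : Fact (Nat.Prime 3) := ⟨Nat.prime_three⟩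
    BSDp W 3 := by
  haveI : Fact (Nat.Prime 3) := ⟨Nat.prime_three⟩
  haveI : Fact (Nat.Prime 5) := ⟨by norm_num⟩
  haveI : Fact (Nat.Prime 31) := ⟨by norm_num⟩
  haveI : Fact (Nat.Prime 41) := ⟨by norm_num⟩
  -- the row `57195f1`
  have hsurj : W.HasSurjectiveModNGaloisRep 3 := GaloisImage.surj3_frob_v57195f1 hI
  have hX : ClassX4 W 3 :=
    ⟨by norm_num, addv_of_intModel hI 3 (by decide) (by decide),
      hasIrreducibleModPGaloisRep_of_hasSurjectiveModNGaloisRep W 3 hsurj⟩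
  have hj : padicValRat 3 W.j < 0 :=
    padicValRat_j_neg_of_intModel hI (p := 3) 2 (by decide) (by decide)
  have hE : (⟨1, -1, 0, 126855, -8937104⟩ : WeierstrassCurve ℤ).map (Int.castRingHom ℚ) = W := by
    rw [IntModelTam.eq_baseChange_of_integralModelInt hI]; rfl
  have hW : W = ⟨1, -1, 0, 126855, -8937104⟩ := by
    rw [← hE]; exact map_mk_int 1 (-1) 0 126855 (-8937104)
  -- the partner `11439d1`: globally minimal, integral model
  haveI hM' : W'.IsGloballyMinimal := by
    rw [hW']
    exact isGloballyMinimal_of_krausCriterion_bounded 0 0 1 (-75) (-68)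
      (by decide +kernel) (by decide +kernel) (by decide +kernel)
  have hI' : integralModelInt W' = ⟨0, 0, 1, -75, -68⟩ := by
    subst hW'; exact integralModelInt_eq_of_map_eq _ (map_mk_int 0 0 1 (-75) (-68))
  have hF : (⟨0, 0, 1, -75, -68⟩ : WeierstrassCurve ℤ).map (Int.castRingHom ℚ) = W' := by
    rw [hW']; exact map_mk_int 0 0 1 (-75) (-68)
  refine X4RankZero.bsdp_three_potMult_of_congr_of_places₇_of_primeList_paidThree hKatoS hDel hGZK
    hmod hmodD hKatoχ hCT hU hU2 W hr hX hsurj hj hq hv W' θ hθ (t := 1) (k := 2)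
    (fun w hw ↦ (LocalTorsion3.natCard_ker_nsmul_three_adicCompletion_eq_one_of_check 0 0 1 (-75) (-68)
      (by decide +kernel) (k := 3) (cert := [((15 : ℤ), 1, 3, 0)]) (by decide +kernel) W' hW' hw).le)
    (by norm_num) hrank hE hF [3, 5, 31, 41] (by decide)
    (X11b.forall_mem_of_natAbs_eq_prod_pow [3, 5, 31, 41] [12, 12, 1, 1] (by intro q hq; simp only [List.mem_cons, List.mem_nil_iff, or_false] at hq; rcases hq with rfl | rfl | rfl | rfl <;> norm_num) (by decide +kernel))
    (X11b.forall_mem_of_natAbs_eq_prod_pow [3, 5, 31, 41] [9, 0, 1, 1] (by intro q hq; simp only [List.mem_cons, List.mem_nil_iff, or_false] at hq; rcases hq with rfl | rfl | rfl | rfl <;> norm_num) (by decide +kernel))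
    (fun v hvL hv3 ↦ ?_)
  simp only [List.mem_cons, List.mem_nil_iff, or_false] at hvL
  rcases hvL with h3 | h5 | h31 | h41
  · -- `v = 3`: the PAID place, excluded here
    exact absurd h3 hv3
  · -- `v = 5`: kind (iv′) — `E` non-split multiplicative, `E′` good, `5 ≠ 3`
    have h5z : ((primesEquiv v : ℕ) : ℤ) = ((5 : ℕ) : ℤ) := by rw [h5]
    refine Or.inr <| Or.inr <| Or.inr <| Or.inl ⟨?_, nonsplit_numeral_57195f1_at5 W hW h5, ?_, ?_⟩
    · exact W.hasMultiplicativeReductionAt_of_dvd_of_not_dvd v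
        (by rw [minimalDiscriminantInt, hI, h5z]; decide +kernel) (by rw [hI, h5z]; decide +kernel)
    · rw [← hF]
      exact hasGoodReductionAt_map_of_not_dvd _ v (by rw [h5z]; decide +kernel)
    · intro hmem
      have h3' := Rat.HeightOneSpectrum.primesEquiv_eq_of_natCast_mem v Nat.prime_three hmem
      omega
  · -- `v = 31`: kind (i) — the partner is non-split `I₁`, `c = 1`, `3 ∤ 1·(31+1)` (p18's recipe)
    refine Or.inl ⟨fun hmem ↦ ?_, ?_⟩
    · have h3' := Rat.HeightOneSpectrum.primesEquiv_eq_of_natCast_mem v Nat.prime_three hmem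
      omega
    · exact LocalTorsionAway.natCard_ker_nsmul_adicCompletion_eq_one_of_intModel_of_nodal_euler hI' 31 3
        (by norm_num) h31 (by decide) (by decide) (by norm_num) nodal_euler_11439d1_31
        (E := ⟨31, 5, 3, 0, 0, 0, 0, 1, 0, 0, 1⟩) rfl tamLocal_check_11439d1_31 (c := 1) (by decide) (by norm_num)
  · -- `v = 41`: kind (iii) — both multiplicative, same twist class, `μ₃ = 1`
    have h41z : ((primesEquiv v : ℕ) : ℤ) = ((41 : ℕ) : ℤ) := by rw [h41]
    refine Or.inr <| Or.inr <| Or.inl ⟨?_, ?_, kind_iii_numerals_57195f1_11439d1_at41 W W' hW hW' h41⟩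
    · exact W.hasMultiplicativeReductionAt_of_dvd_of_not_dvd v
        (by rw [minimalDiscriminantInt, hI, h41z]; decide +kernel) (by rw [hI, h41z]; decide +kernel)
    · exact W'.hasMultiplicativeReductionAt_of_dvd_of_not_dvd v
        (by rw [minimalDiscriminantInt, hI', h41z]; decide +kernel) (by rw [hI', h41z]; decide +kernel)

end Summit.BirchSwinnertonDyer.Rank1Residual.Additive

end
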